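import Mathlib.RingTheory.PowerSeries.Substitution
import Mathlib.RingTheory.PowerSeries.Expand
import Mathlib.NumberTheory.Padics.RingHoms
import Mathlib.RingTheory.Polynomial.RationalRoot
import Mathlib.Data.Nat.Factorization.Basic
import Literature.NumberTheory.EllipticCurves.HondaStrongIsomorphismProofs
import Literature.NumberTheory.EllipticCurves.FormalLogExpBaseChangeProofs
import Literature.NumberTheory.EllipticCurves.FormalLeafDenominatorsProofs
import Literature.NumberTheory.EllipticCurves.GlobalMinimalModel
import Literature.NumberTheory.EllipticCurves.Greenberg1999.TwoTorsionMuInvariant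
import Summits.BirchSwinnertonDyer.BirchSwinnertonDyer.Theorems.EisensteinDepletionAtTwoStarGO2KEtaKernelA
import Summits.BirchSwinnertonDyer.BirchSwinnertonDyer.Theorems.EisensteinDepletionAtTwoStarGO2KEtaHondaTheoremKWitt
import Summits.BirchSwinnertonDyer.BirchSwinnertonDyer.Theorems.EisensteinDepletionAtTwoStarOptBNSFParamIntegral
import HarnessLib

/-!
# THEOREM K at the Honda point — the arithmetic pattern (KEtaHondaPointPattern, part 10a)
(crux `StarGO2Sigma`, stmt-BirchSwinnertonDyer-27046; line kummer, research stub `stub_discrepancyCover`)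

Planner bsd-rank2-p2 GEN 38.  Tree-only arithmetic for PART 10 (`KEtaHondaPoint`): the Honda point
`Z_c = exp_W(c·ℓ)`, `ℓ = Σ aₙqⁿ/n` (`ParamIntegral`), its `2`-adic logarithm `log_W(Z_c) = c·ℓ`, the reduction of the
integral `λ`-series `λ_α(ℓ) = ℓ − (α/2)ℓ(q²) ∈ ℤ₂⟦q⟧` modulo `2` — `[qⁿ]λ̄ = ā_{n′}`, `n′` the odd part of `n` (Hecke at `2`:
`hondaShift 2 a₂ ℓ` vanishes in even degrees) — its Artin–Schreier root `Σ_j λ̄^{2^j} = Σ_{v₂(n) even} ā_{n′} qⁿ`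
(the mod-`2` CLASS PATTERN of K-ETA.md (★η)), and the integrality of an étale rational `2`-torsion abscissa.
Nothing here reads `r_an`; `StarGO2Sigma` / E1M / BSD are NOT proved by this file.
-/

set_option linter.dupNamespace false
set_option linter.unusedSectionVars false
set_option autoImplicit false

noncomputable section

namespace Summit.BirchSwinnertonDyer.BirchSwinnertonDyer.Theorems.DepletionAtTwo.KEta.HondaPoint

open PowerSeries Literature.RingTheory.FormalGroups Literature.NumberTheory.EllipticCurves

/-! ### The odd part `n ↦ n / 2^{v₂(n)}` -/

/-- `v₂(2m) = v₂(m) + 1` for `m ≠ 0`. [folklore] -/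
theorem factorization_two_mul {m : ℕ} (hm : m ≠ 0) : (2 * m).factorization 2 = m.factorization 2 + 1 := by
  rw [Nat.factorization_mul two_ne_zero hm, Finsupp.add_apply, Nat.Prime.factorization_self Nat.prime_two,
    add_comm]

/-- Auxiliary (oddPart two mul): bookkeeping lemma of p2 GEN 38 PART 10 (THEOREM K at the Honda point). [folklore] -/
theorem oddPart_two_mul {m : ℕ} (hm : m ≠ 0) :
    (2 * m) / 2 ^ (2 * m).factorization 2 = m / 2 ^ m.factorization 2 := by
  rw [factorization_two_mul hm, pow_succ', Nat.mul_div_mul_left _ _ two_pos]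

/-- Auxiliary (oddPart of not two dvd): bookkeeping lemma of p2 GEN 38 PART 10 (THEOREM K at the Honda point). [folklore] -/
theorem oddPart_of_not_two_dvd {n : ℕ} (hn : ¬ 2 ∣ n) : n / 2 ^ n.factorization 2 = n := by
  rw [Nat.factorization_eq_zero_of_not_dvd hn, pow_zero, Nat.div_one]

/-! ### The two `𝔽₂`-patterns attached to a sequence `a : ℕ → R` -/

section Pattern

variable {R : Type*} [CommRing R]

/-- `λ-pattern`: `Σ_{n ≥ 1} a(n′) qⁿ`, `n′` the odd part of `n`. -/
def lamSeries (a : ℕ → R) : R⟦X⟧ :=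
  PowerSeries.mk fun n => if n = 0 then 0 else a (n / 2 ^ n.factorization 2)

/-- CLASS pattern: `Σ_{n ≥ 1, v₂(n) even} a(n′) qⁿ`. -/
def patSeries (a : ℕ → R) : R⟦X⟧ :=
  PowerSeries.mk fun n => if n = 0 then 0 else if Even (n.factorization 2) then a (n / 2 ^ n.factorization 2) else 0

/-- Auxiliary (coeff lamSeries): bookkeeping lemma of p2 GEN 38 PART 10 (THEOREM K at the Honda point). [folklore] -/
theorem coeff_lamSeries (a : ℕ → R) (n : ℕ) :
    coeff n (lamSeries a) = if n = 0 then 0 else a (n / 2 ^ n.factorization 2) := by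
  rw [lamSeries, coeff_mk]

/-- Auxiliary (coeff patSeries): bookkeeping lemma of p2 GEN 38 PART 10 (THEOREM K at the Honda point). [folklore] -/
theorem coeff_patSeries (a : ℕ → R) (n : ℕ) :
    coeff n (patSeries a) =
      if n = 0 then 0 else if Even (n.factorization 2) then a (n / 2 ^ n.factorization 2) else 0 := by
  rw [patSeries, coeff_mk]

/-- Auxiliary (constantCoeff lamSeries): bookkeeping lemma of p2 GEN 38 PART 10 (THEOREM K at the Honda point). [folklore] -/
theorem constantCoeff_lamSeries (a : ℕ → R) : constantCoeff (lamSeries a) = 0 := by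
  rw [← coeff_zero_eq_constantCoeff_apply, coeff_lamSeries, if_pos rfl]

/-- Auxiliary (constantCoeff patSeries): bookkeeping lemma of p2 GEN 38 PART 10 (THEOREM K at the Honda point). [folklore] -/
theorem constantCoeff_patSeries (a : ℕ → R) : constantCoeff (patSeries a) = 0 := by
  rw [← coeff_zero_eq_constantCoeff_apply, coeff_patSeries, if_pos rfl]

/-- Auxiliary (lamSeries map): bookkeeping lemma of p2 GEN 38 PART 10 (THEOREM K at the Honda point). [folklore] -/
theorem lamSeries_map {S : Type*} [CommRing S] (f : R →+* S) (a : ℕ → R) :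
    (lamSeries a).map f = lamSeries (fun n => f (a n)) := by
  ext n; rw [coeff_map, coeff_lamSeries, coeff_lamSeries]; split_ifs <;> simp

/-- Auxiliary (patSeries map): bookkeeping lemma of p2 GEN 38 PART 10 (THEOREM K at the Honda point). [folklore] -/
theorem patSeries_map {S : Type*} [CommRing S] (f : R →+* S) (a : ℕ → R) :
    (patSeries a).map f = patSeries (fun n => f (a n)) := by
  ext n; rw [coeff_map, coeff_patSeries, coeff_patSeries]; split_ifs <;> simp

end Pattern

/-- Over `𝔽₂`, `f² = f(q²)`. -/
theorem sq_eq_expand_zmod (f : (ZMod 2)⟦X⟧) : f ^ 2 = expand 2 Kernel.two_ne_zero' f := by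
  have h := Kernel.expand_map_frobenius f
  rw [ZMod.frobenius_zmod, map_id] at h
  exact h.symm

/-- **The Artin–Schreier equation of the class pattern**: `P − P² = Λ-pattern` in `𝔽₂⟦q⟧`. -/
theorem patSeries_sub_sq (a : ℕ → ZMod 2) : patSeries a - patSeries a ^ 2 = lamSeries a := by
  ext n
  rw [map_sub, sq_eq_expand_zmod, coeff_expand, coeff_patSeries, coeff_lamSeries]
  rcases Nat.eq_zero_or_pos n with rfl | hn
  · simp [coeff_patSeries]
  rw [if_neg hn.ne', if_neg hn.ne']
  by_cases h2 : 2 ∣ n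
  · obtain ⟨m, rfl⟩ := h2
    have hm : m ≠ 0 := by rintro rfl; exact lt_irrefl 0 hn
    rw [if_pos (dvd_mul_right 2 m), Nat.mul_div_cancel_left m two_pos, coeff_patSeries, if_neg hm,
      oddPart_two_mul hm, factorization_two_mul hm]
    by_cases he : Even (m.factorization 2)
    · rw [if_neg (Nat.even_add_one.not.mpr (not_not.mpr he)), if_pos he, zero_sub, CharTwo.neg_eq]
    · rw [if_pos (Nat.even_add_one.mpr he), if_neg he, sub_zero]
  · rw [if_neg h2, sub_zero, Nat.factorization_eq_zero_of_not_dvd h2, if_pos Even.zero]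

/-- With a multiplier `c̄ ∈ 𝔽₂` (`c̄² = c̄`). -/
theorem C_mul_patSeries_sub_sq (c : ZMod 2) (a : ℕ → ZMod 2) :
    C c * patSeries a - (C c * patSeries a) ^ 2 = C c * lamSeries a := by
  rw [mul_pow, ← map_pow, ZMod.pow_card, ← mul_sub, patSeries_sub_sq]

/-! ### `λ_α` is `ℚ_p`-linear -/

/-- `λ_α(c·ℓ) = c·λ_α(ℓ)` (linearity of the Frobenius-twisted operator). [folklore] -/
theorem frobLambda_C_mul {p : ℕ} [Fact p.Prime] (α c : ℚ_[p]) (ℓ : ℚ_[p]⟦X⟧) :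
    HondaLambda.frobLambda α (C c * ℓ) = C c * HondaLambda.frobLambda α ℓ := by
  rw [HondaLambda.frobLambda_def, HondaLambda.frobLambda_def, map_mul, expand_C]; ring

/-! ### The `2`-adic `L`-series logarithm of a globally minimal curve and its `λ`-series modulo `2` -/

section Ell

variable (W : WeierstrassCurve ℚ) [W.IsElliptic] [W.IsGloballyMinimal]

/-- `ℓ = Σ aₙ(W) qⁿ/n ∈ ℚ⟦q⟧`. -/
def ell : ℚ⟦X⟧ := PowerSeries.mk fun j => ((W.LFunction j : ℤ) : ℚ) / j

/-- `ℓ` read in `ℚ₂⟦q⟧`. -/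
def ellTwo : ℚ_[2]⟦X⟧ := PowerSeries.mk fun j => ((W.LFunction j : ℤ) : ℚ_[2]) / j

/-- Auxiliary (ell map): bookkeeping lemma of p2 GEN 38 PART 10 (THEOREM K at the Honda point). [folklore] -/
theorem ell_map : (ell W).map (algebraMap ℚ ℚ_[2]) = ellTwo W := by
  ext j
  rw [coeff_map, ell, ellTwo, coeff_mk, coeff_mk, map_div₀, map_intCast, map_natCast]

/-- Auxiliary (constantCoeff ell): bookkeeping lemma of p2 GEN 38 PART 10 (THEOREM K at the Honda point). [folklore] -/
theorem constantCoeff_ell : constantCoeff (ell W) = 0 := by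
  rw [← coeff_zero_eq_constantCoeff_apply, ell, coeff_mk, Nat.cast_zero, div_zero]

/-- Auxiliary (constantCoeff ellTwo): bookkeeping lemma of p2 GEN 38 PART 10 (THEOREM K at the Honda point). [folklore] -/
theorem constantCoeff_ellTwo : constantCoeff (ellTwo W) = 0 := by
  rw [← coeff_zero_eq_constantCoeff_apply, ellTwo, coeff_mk, Nat.cast_zero, div_zero]

/-- **Hecke at a good `2`**: `hondaShift 2 a₂ ℓ = Σ_{n odd} aₙqⁿ/n` (tree `coeff_hondaShift_mk_div` with
`lFunction_prime_mul_of_not_dvd`). -/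
theorem coeff_hondaShift_ellTwo (hgood : ¬ (2 : ℤ) ∣ WeierstrassCurve.minimalDiscriminantInt W) (n : ℕ) :
    coeff n (hondaShift 2 ((W.LFunction 2 : ℤ) : ℚ_[2]) (ellTwo W)) =
      if 2 ∣ n then 0 else ((W.LFunction n : ℤ) : ℚ_[2]) / n := by
  have h := coeff_hondaShift_mk_div (p := 2) (fun k => ((W.LFunction k : ℤ) : ℚ_[2])) ?_ ?_ n
  · simpa [ellTwo] using h
  · rw [ArithmeticFunction.map_zero, Int.cast_zero]
  · intro m _
    rw [W.lFunction_prime_mul_of_not_dvd 2 (by exact_mod_cast hgood) m]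
    split_ifs <;> push_cast <;> ring

/-- `ℓ` is of Honda type `2 − a₂T + T²` at a good `2` (tree `norm_coeff_hondaShift_lSeriesLog_le_one`). -/
theorem hondaType_ellTwo (hgood : ¬ (2 : ℤ) ∣ WeierstrassCurve.minimalDiscriminantInt W) (n : ℕ) :
    ‖coeff n (hondaShift 2 ((W.LFunction 2 : ℤ) : ℚ_[2]) (ellTwo W))‖ ≤ 1 :=
  W.norm_coeff_hondaShift_lSeriesLog_le_one (p := 2) (by exact_mod_cast hgood) n

/-- **The integral `λ`-series of `ℓ` modulo `2`**: if `Λ ∈ ℤ₂⟦q⟧` lifts `λ_α(ℓ) = ℓ − (α/2)ℓ(q²)` for the unit root `α`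
of `X² − a₂X + 2`, then `Λ̄ = Σ_{n ≥ 1} ā_{n′} qⁿ` (`n′` the odd part of `n`): by the recursion
`[qⁿ]λ = [qⁿ]hondaShift + α⁻¹[q^{n/2}]λ` (tree `coeff_frobLambda_eq`) and `coeff_hondaShift_ellTwo`. -/
theorem map_toZMod_eq_lamSeries (hgood : ¬ (2 : ℤ) ∣ WeierstrassCurve.minimalDiscriminantInt W)
    {α : ℤ_[2]} (hαn : ‖α‖ = 1)
    (hroot : (α : ℚ_[2]) ^ 2 - ((W.LFunction 2 : ℤ) : ℚ_[2]) * α + 2 = 0)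
    {Λ : ℤ_[2]⟦X⟧} (hΛ : Λ.map (PadicInt.Coe.ringHom (p := 2)) = HondaLambda.frobLambda (α : ℚ_[2]) (ellTwo W)) :
    Λ.map (PadicInt.toZMod (p := 2)) = lamSeries (fun n => ((W.LFunction n : ℤ) : ZMod 2)) := by
  set ρ : ℤ_[2] →+* ZMod 2 := PadicInt.toZMod (p := 2) with hρ
  have hα0 : (α : ℚ_[2]) ≠ 0 := fun h => by
    rw [PadicInt.coe_eq_zero] at h
    rw [h, norm_zero] at hαn; exact zero_ne_one hαn
  have hroot' : (α : ℚ_[2]) ^ 2 - ((W.LFunction 2 : ℤ) : ℚ_[2]) * α + (2 : ℕ) = 0 := by exact_mod_cast hroot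
  have hρα : ρ α = 1 := by
    refine (show ∀ {x : ZMod 2}, x ≠ 0 → x = 1 by decide) fun h0 => ?_
    have hmem : α ∈ RingHom.ker ρ := (RingHom.mem_ker).mpr h0
    rw [hρ, PadicInt.ker_toZMod, IsLocalRing.mem_maximalIdeal, mem_nonunits_iff] at hmem
    exact hmem (PadicInt.isUnit_iff.mpr hαn)
  -- coefficient recursion in `ℤ₂`
  have hcoe : ∀ n, ((coeff n Λ : ℤ_[2]) : ℚ_[2]) = coeff n (HondaLambda.frobLambda (α : ℚ_[2]) (ellTwo W)) :=
    fun n => by rw [← hΛ, coeff_map]; rfl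
  have hrec : ∀ n, ((coeff n Λ : ℤ_[2]) : ℚ_[2]) =
      (if 2 ∣ n then 0 else ((W.LFunction n : ℤ) : ℚ_[2]) / n) +
        (α : ℚ_[2])⁻¹ * (if 2 ∣ n then ((coeff (n / 2) Λ : ℤ_[2]) : ℚ_[2]) else 0) := fun n => by
    rw [hcoe, HondaLambda.coeff_frobLambda_eq hα0 hroot' (ellTwo W) n, coeff_hondaShift_ellTwo W hgood n]
    split_ifs with h
    · rw [hcoe]
    · rfl
  ext n
  rw [coeff_map, coeff_lamSeries]
  induction n using Nat.strong_induction_on with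
  | _ n ih =>
    rcases Nat.eq_zero_or_pos n with rfl | hn
    · rw [if_pos rfl]
      have h0 : ((coeff 0 Λ : ℤ_[2]) : ℚ_[2]) = 0 := by
        rw [hcoe, coeff_zero_eq_constantCoeff_apply, HondaLambda.constantCoeff_frobLambda (constantCoeff_ellTwo W)]
      rw [PadicInt.coe_eq_zero] at h0
      rw [h0, map_zero]
    rw [if_neg hn.ne']
    by_cases h2 : 2 ∣ n
    · -- even: `α Λ_n = Λ_{n/2}`
      obtain ⟨m, rfl⟩ := h2
      have hm : m ≠ 0 := by rintro rfl; exact lt_irrefl 0 hn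
      have hmlt : m < 2 * m := by omega
      have h := hrec (2 * m)
      rw [if_pos (dvd_mul_right 2 m), if_pos (dvd_mul_right 2 m), zero_add, Nat.mul_div_cancel_left m two_pos] at h
      have h' : α * coeff (2 * m) Λ = coeff m Λ := by
        apply Subtype.ext
        push_cast
        rw [h, ← mul_assoc, mul_inv_cancel₀ hα0, one_mul]
      have h'' := congrArg ρ h'
      rw [map_mul, hρα, one_mul] at h''
      have ihm := ih m hmlt
      rw [if_neg hm] at ihm
      rw [h'', ihm, oddPart_two_mul hm]
    · -- odd: `n Λ_n = a_n`
      have h := hrec n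
      rw [if_neg h2, if_neg h2, mul_zero, add_zero] at h
      have hn0 : (n : ℚ_[2]) ≠ 0 := by exact_mod_cast hn.ne'
      have h' : (n : ℤ_[2]) * coeff n Λ = (W.LFunction n : ℤ) := by
        apply Subtype.ext
        push_cast
        rw [h, mul_div_cancel₀ _ hn0]
      have h'' := congrArg ρ h'
      rw [map_mul, map_natCast, map_intCast, (ZMod.natCast_eq_one_iff_odd.mpr (Nat.odd_iff.mpr (Nat.two_dvd_ne_zero.mp h2))),
        one_mul] at h''
      rw [h'', oddPart_of_not_two_dvd h2]

end Ell

end Summit.BirchSwinnertonDyer.BirchSwinnertonDyer.Theorems.DepletionAtTwo.KEta.HondaPoint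

end
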